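import Mathlib.Analysis.SpecialFunctions.Sqrt
import Mathlib.Analysis.InnerProductSpace.Calculus
import Mathlib.Topology.OpenPartialHomeomorph.Basic
import Literature.Topology.FourManifolds.RadialDiffeomorph
import Literature.Geometry.Lorentzian.NearKerrLeaf
import Summits.FinalStateConjecture.FinalStateConjecture.Theorems.EIHFluxBalanceInertialRecessionLorentz
import HarnessLib

/-!
# Helper for stub `stub_phantomSucc` of line `Sketch` of crux `Capture`
# (stmt-FinalStateConjecture-10115): the translated bending map and bounded tube sections

Auxiliary, definition-free calculus for `BartnikGapSettlingCaptureStubPhantomSucc.lean` (same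
directory: the phantom hole at every hole count `N → N + 1` of a near-Kerr leaf,
`CauchyDevelopment.IsNearKerrLeaf`, `Literature/Geometry/Lorentzian/NearKerrLeaf.lean`).

* §1 `exists_bend`: for `M' > 0` and a centre `ξ ∈ E3`, an open partial homeomorphism `e` of
  `E4` with source the slab-shell `{−1 < y⁰ < 1, M' < |y̲ − ξ| < M' + 1}`, smooth on its source,
  with HYPERBOLOIDAL time `t₀(e y) = (e y)⁰ − √(1 + |e y̲|²) = y⁰`, values in the spatial ball
  `{|x̲ − ξ| < 5M'/4}`, and target containing the cap `{t₀ = 0, M'/2 < |x̲ − ξ| < M'}`: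
  `e (y⁰, y̲) = (y⁰ + √(1 + |ξ + φ(y̲ − ξ)|²), ξ + φ(y̲ − ξ))`, `φ` the radial map
  (`Literature.Topology.FourManifolds.radialMap`) of affine profile `p s = M'/4 + M'(s − M')`, with
  inverse `(x⁰, x̲) ↦ (t₀ x, ξ + ψ(x̲ − ξ))`, `ψ` radial of profile `q u = M' + (u − M'/4)/M'`.
* §2 `stub_phantomSuccTube` (registered sub-goal): BOUNDED TUBE SECTIONS.  For a motion `(Λ, c)`,
  a spin `a` and a radius `ρ`, the part of the boosted tube `{x | r_a(Λ⁻¹(x − c)) ≤ ρ}` inside the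
  hyperboloidal layer `{−1 < t₀ < 1}` is bounded: writing `x = c + Λ(s e₀ + w)` with `w⁰ = 0`,
  `‖w‖² ≤ ρ² + a²` (`Kerr.spatialNorm_sq_sub_sq_le_radius_sq`), and the unit timelike vector
  `u = Λ e₀` has `|u⁰| − |ũ| = 1/(|u⁰| + |ũ|) > 0` (`lorentz_apply_zero_sq`), so the two bounds
  `0 < x⁰ < 2 + |x̲|` implied by `−1 < t₀ x < 1` pinch `|s|`.
* §3 `Fin (N + 1)` bookkeeping (unions / pairwise disjointness of families with empty `0`-th
  member).

References: Dafermos–Holzegel–Rodnianski–Taylor arXiv:2104.08222, §1 (leaf vocabulary); O'Neill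
1983, Ch. 9, pp. 233–236 (`O(1,3)`); hyperboloids of Minkowski space: folklore.  No definitions.
-/

-- the doubled `FinalStateConjecture.FinalStateConjecture` path component trips dupNamespace
set_option linter.dupNamespace false

noncomputable section

namespace Summit.FinalStateConjecture.FinalStateConjecture.Theorems.BartnikGapSettling.Capture
namespace PhantomSucc

open Set Filter Topology TopologicalSpace
open scoped Manifold ContDiff ENNReal
open Literature.Geometry.Lorentzian
open Literature.Topology.FourManifolds (radialMap norm_radialMap radialMap_radialMap
  contDiffAt_radialMap)

/-! ### §1 The translated bending map and its inverse -/

section Bend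

variable {p q : ℝ → ℝ} {ξ : E3} {F G : E4 → E4}
  (hF : ∀ y, F y = E4.ofTimeSpace (y 0 + √(1 + ‖ξ + radialMap p (E4.spatial y - ξ)‖ ^ 2))
    (ξ + radialMap p (E4.spatial y - ξ)))
  (hG : ∀ x, G x = E4.ofTimeSpace (x 0 - √(1 + E4.spatialNorm x ^ 2))
    (ξ + radialMap q (E4.spatial x - ξ)))

include hF in
/-- The translated bending map `F (y⁰, y̲) = (y⁰ + √(1 + |ξ + φ(y̲ − ξ)|²), ξ + φ(y̲ − ξ))` has
hyperboloidal time `y⁰`. [folklore] -/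
theorem time_bend (y : E4) : F y 0 - √(1 + E4.spatialNorm (F y) ^ 2) = y 0 := by
  rw [hF, E4.ofTimeSpace_apply_zero, E4.spatialNorm_ofTimeSpace]
  ring

include hF in
/-- The spatial part of the translated bending map, seen from the centre `ξ`, is the radial map
`φ = radialMap p` applied to `y̲ − ξ`. [folklore] -/
theorem spatial_bend_sub (y : E4) : E4.spatial (F y) - ξ = radialMap p (E4.spatial y - ξ) := by
  rw [hF, E4.spatial_ofTimeSpace, add_sub_cancel_left]

include hF in
/-- Off the axis `{y̲ = ξ}` the bent point has distance `|p |y̲ − ξ||` from `ξ`. [folklore] -/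
theorem norm_spatial_bend_sub {y : E4} (hy : E4.spatial y - ξ ≠ 0) :
    ‖E4.spatial (F y) - ξ‖ = |p ‖E4.spatial y - ξ‖| := by
  rw [spatial_bend_sub hF, norm_radialMap p hy]

include hG in
/-- The time coordinate of the unbending map `G (x⁰, x̲) = (t₀ x, ξ + ψ(x̲ − ξ))`. [folklore] -/
theorem time_unbend (x : E4) : G x 0 = x 0 - √(1 + E4.spatialNorm x ^ 2) := by
  rw [hG, E4.ofTimeSpace_apply_zero]

include hG in
/-- The spatial part of the unbending map, seen from `ξ`, is `ψ = radialMap q` applied to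
`x̲ − ξ`. [folklore] -/
theorem spatial_unbend_sub (x : E4) : E4.spatial (G x) - ξ = radialMap q (E4.spatial x - ξ) := by
  rw [hG, E4.spatial_ofTimeSpace, add_sub_cancel_left]

include hG in
/-- Off the axis `{x̲ = ξ}` the unbent point has distance `|q |x̲ − ξ||` from `ξ`. [folklore] -/
theorem norm_spatial_unbend_sub {x : E4} (hx : E4.spatial x - ξ ≠ 0) :
    ‖E4.spatial (G x) - ξ‖ = |q ‖E4.spatial x - ξ‖| := by
  rw [spatial_unbend_sub hG, norm_radialMap q hx]

include hF hG in
/-- `G ∘ F = id` off the axis, where `p |y̲ − ξ| > 0` and `q (p |y̲ − ξ|) = |y̲ − ξ|`. [folklore] -/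
theorem unbend_bend {y : E4} (hy : E4.spatial y - ξ ≠ 0) (hp : 0 < p ‖E4.spatial y - ξ‖)
    (hqp : q (p ‖E4.spatial y - ξ‖) = ‖E4.spatial y - ξ‖) : G (F y) = y := by
  rw [hG, time_bend hF, spatial_bend_sub hF, radialMap_radialMap q p hy hp, hqp,
    mul_inv_cancel₀ (norm_ne_zero_iff.2 hy), one_smul, add_sub_cancel]
  exact E4.ofTimeSpace_time_spatial y

include hF hG in
/-- `F ∘ G = id` off the axis, where `q |x̲ − ξ| > 0` and `p (q |x̲ − ξ|) = |x̲ − ξ|`. [folklore] -/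
theorem bend_unbend {x : E4} (hx : E4.spatial x - ξ ≠ 0) (hq : 0 < q ‖E4.spatial x - ξ‖)
    (hpq : p (q ‖E4.spatial x - ξ‖) = ‖E4.spatial x - ξ‖) : F (G x) = x := by
  rw [hF, spatial_unbend_sub hG, time_unbend hG, radialMap_radialMap p q hx hq, hpq,
    mul_inv_cancel₀ (norm_ne_zero_iff.2 hx), one_smul, add_sub_cancel, E4.spatialNorm,
    sub_add_cancel]
  exact E4.ofTimeSpace_time_spatial x

include hF in
/-- The translated bending map is smooth off the axis when its profile is smooth at `|y̲ − ξ|`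
(the norm is smooth off `0`, `contDiffAt_radialMap`; `√` is smooth on `(0, ∞)`). [folklore] -/
theorem contDiffAt_bend {y : E4} (hy : E4.spatial y - ξ ≠ 0)
    (hp : ContDiffAt ℝ ∞ p ‖E4.spatial y - ξ‖) : ContDiffAt ℝ ∞ F y := by
  have hd : ContDiffAt ℝ ∞ (fun x : E4 => E4.spatial x - ξ) y :=
    E4.spatial.contDiff.contDiffAt.sub contDiffAt_const
  have hφ₀ : ContDiffAt ℝ ∞ (fun x : E4 => radialMap p (E4.spatial x - ξ)) y :=
    ContDiffAt.comp (g := radialMap p) (f := fun x : E4 => E4.spatial x - ξ) y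
      (contDiffAt_radialMap hy hp) hd
  have hφ : ContDiffAt ℝ ∞ (fun x : E4 => ξ + radialMap p (E4.spatial x - ξ)) y :=
    contDiffAt_const.add hφ₀
  have h0 : ContDiffAt ℝ ∞ (fun x : E4 => x 0) y := by fun_prop
  have hs : ContDiffAt ℝ ∞
      (fun x : E4 => x 0 + √(1 + ‖ξ + radialMap p (E4.spatial x - ξ)‖ ^ 2)) y :=
    h0.add ((contDiffAt_const.add (hφ.norm_sq ℝ)).sqrt (by positivity))
  rw [contDiffAt_euclidean]
  refine Fin.cases ?_ (fun j => ?_)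
  · simp only [hF, E4.ofTimeSpace_apply_zero]
    exact hs
  · simp only [hF, E4.ofTimeSpace_apply_succ]
    exact contDiffAt_euclidean.1 hφ j

include hG in
/-- The unbending map is smooth off the axis if its profile is smooth at `|x̲ − ξ|`. [folklore] -/
theorem contDiffAt_unbend {x : E4} (hx : E4.spatial x - ξ ≠ 0)
    (hq : ContDiffAt ℝ ∞ q ‖E4.spatial x - ξ‖) : ContDiffAt ℝ ∞ G x := by
  have hd : ContDiffAt ℝ ∞ (fun x : E4 => E4.spatial x - ξ) x :=
    E4.spatial.contDiff.contDiffAt.sub contDiffAt_const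
  have hψ₀ : ContDiffAt ℝ ∞ (fun x : E4 => radialMap q (E4.spatial x - ξ)) x :=
    ContDiffAt.comp (g := radialMap q) (f := fun x : E4 => E4.spatial x - ξ) x
      (contDiffAt_radialMap hx hq) hd
  have hψ : ContDiffAt ℝ ∞ (fun x : E4 => ξ + radialMap q (E4.spatial x - ξ)) x :=
    contDiffAt_const.add hψ₀
  have h0 : ContDiffAt ℝ ∞ (fun x : E4 => x 0) x := by fun_prop
  have hs : ContDiffAt ℝ ∞ (fun x : E4 => x 0 - √(1 + E4.spatialNorm x ^ 2)) x := by
    simp only [E4.spatialNorm]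
    exact h0.sub ((contDiffAt_const.add (E4.spatial.contDiff.contDiffAt.norm_sq ℝ)).sqrt
      (by positivity))
  rw [contDiffAt_euclidean]
  refine Fin.cases ?_ (fun j => ?_)
  · simp only [hG, E4.ofTimeSpace_apply_zero]
    exact hs
  · simp only [hG, E4.ofTimeSpace_apply_succ]
    exact contDiffAt_euclidean.1 hψ j

end Bend

/-- **The translated bending partial homeomorphism.** For `M' > 0` and `ξ ∈ E3` there is an open
partial homeomorphism `e` of `E4` with source the shell `{−1 < y⁰ < 1, M' < |y̲ − ξ| < M' + 1}`,
with hyperboloidal time `t₀(e y) = y⁰`, values within spatial distance `5M'/4` of `ξ` on its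
source, smooth on its source, and whose target contains the cap `{t₀ = 0, M'/2 < |x̲ − ξ| < M'}`:
`e (y⁰, y̲) = (y⁰ + √(1 + |ξ + φ(y̲ − ξ)|²), ξ + φ(y̲ − ξ))`, `φ` radial of profile
`p s = M'/4 + M'(s − M')` (shell `(M', M'+1)` onto `(M'/4, 5M'/4)`), inverse
`(x⁰, x̲) ↦ (t₀ x, ξ + ψ(x̲ − ξ))`, `ψ` radial of profile `q u = M' + (u − M'/4)/M'`. [folklore] -/
theorem exists_bend {M' : ℝ} (hM' : 0 < M') (ξ : E3) : ∃ e : OpenPartialHomeomorph E4 E4,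
    (∀ y, y ∈ e.source ↔
      -1 < y 0 ∧ y 0 < 1 ∧ M' < ‖E4.spatial y - ξ‖ ∧ ‖E4.spatial y - ξ‖ < M' + 1) ∧
    (∀ y, e y 0 - √(1 + E4.spatialNorm (e y) ^ 2) = y 0) ∧
    (∀ y ∈ e.source, ‖E4.spatial (e y) - ξ‖ < 5 * M' / 4) ∧
    (∀ y ∈ e.source, ContDiffAt ℝ ∞ e y) ∧
    ∀ x : E4, x 0 - √(1 + E4.spatialNorm x ^ 2) = 0 → M' / 2 < ‖E4.spatial x - ξ‖ →
      ‖E4.spatial x - ξ‖ < M' → x ∈ e.target := by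
  have hM0 : M' ≠ 0 := hM'.ne'
  -- the two radial profiles
  obtain ⟨p, hp⟩ : ∃ p : ℝ → ℝ, ∀ s, p s = M' / 4 + M' * (s - M') := ⟨_, fun _ => rfl⟩
  obtain ⟨q, hq⟩ : ∃ q : ℝ → ℝ, ∀ u, q u = M' + (u - M' / 4) / M' := ⟨_, fun _ => rfl⟩
  have hqp : ∀ s, q (p s) = s := fun s => by rw [hq, hp]; field_simp; ring
  have hpq : ∀ u, p (q u) = u := fun u => by rw [hp, hq]; field_simp; ring
  have hp_gt : ∀ s, M' < s → M' / 4 < p s := fun s hs => by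
    rw [hp]; nlinarith [mul_pos hM' (sub_pos.2 hs)]
  have hp_lt : ∀ s, s < M' + 1 → p s < 5 * M' / 4 := fun s hs => by
    rw [hp]; nlinarith [mul_lt_mul_of_pos_left (show s - M' < 1 by linarith) hM']
  have hq_gt : ∀ u, M' / 4 < u → M' < q u := fun u hu => by
    rw [hq]; linarith [div_pos (show 0 < u - M' / 4 by linarith) hM']
  have hq_lt : ∀ u, u < 5 * M' / 4 → q u < M' + 1 := fun u hu => by
    rw [hq]; linarith [(div_lt_one hM').2 (show u - M' / 4 < M' by linarith)]
  have hpc : ContDiff ℝ ∞ p := by rw [funext hp]; fun_prop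
  have hqc : ContDiff ℝ ∞ q := by rw [funext hq]; fun_prop
  -- the bending map and its inverse
  obtain ⟨F, hF⟩ : ∃ F : E4 → E4, ∀ y, F y =
      E4.ofTimeSpace (y 0 + √(1 + ‖ξ + radialMap p (E4.spatial y - ξ)‖ ^ 2))
        (ξ + radialMap p (E4.spatial y - ξ)) := ⟨_, fun _ => rfl⟩
  obtain ⟨G, hG⟩ : ∃ G : E4 → E4, ∀ x, G x =
      E4.ofTimeSpace (x 0 - √(1 + E4.spatialNorm x ^ 2)) (ξ + radialMap q (E4.spatial x - ξ)) :=
    ⟨_, fun _ => rfl⟩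
  have h0c : Continuous fun x : E4 => x 0 := by fun_prop
  have hdc : Continuous fun x : E4 => ‖E4.spatial x - ξ‖ := (E4.spatial.continuous.sub
    continuous_const).norm
  have ht₀c : Continuous fun x : E4 => x 0 - √(1 + E4.spatialNorm x ^ 2) := by
    unfold E4.spatialNorm; fun_prop
  have hne : ∀ y : E4, M' / 4 < ‖E4.spatial y - ξ‖ → E4.spatial y - ξ ≠ 0 := fun y hy h => by
    rw [h, norm_zero] at hy; linarith
  refine
    ⟨{toFun := F
      invFun := G
      source := {y | -1 < y 0 ∧ y 0 < 1 ∧ M' < ‖E4.spatial y - ξ‖ ∧ ‖E4.spatial y - ξ‖ < M' + 1}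
      target := {x | -1 < x 0 - √(1 + E4.spatialNorm x ^ 2) ∧
        x 0 - √(1 + E4.spatialNorm x ^ 2) < 1 ∧
          M' / 4 < ‖E4.spatial x - ξ‖ ∧ ‖E4.spatial x - ξ‖ < 5 * M' / 4}
      map_source' := ?_
      map_target' := ?_
      left_inv' := ?_
      right_inv' := ?_
      continuousOn_toFun := ?_
      continuousOn_invFun := ?_
      open_source := ?_
      open_target := ?_ },
      fun y => Iff.rfl, fun y => time_bend hF y, ?_, fun y hy => ?_, fun x h0 h1 h2 => ?_⟩
  · rintro y ⟨h1, h2, h3, h4⟩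
    have hy := hne y (by linarith)
    have hpos : 0 < p ‖E4.spatial y - ξ‖ := lt_trans (by positivity) (hp_gt _ h3)
    refine ⟨by rw [time_bend hF]; exact h1, by rw [time_bend hF]; exact h2, ?_, ?_⟩
    · rw [norm_spatial_bend_sub hF hy, abs_of_pos hpos]
      exact hp_gt _ h3
    · rw [norm_spatial_bend_sub hF hy, abs_of_pos hpos]
      exact hp_lt _ h4
  · rintro x ⟨h1, h2, h3, h4⟩
    have hx := hne x h3
    have hpos : 0 < q ‖E4.spatial x - ξ‖ := hM'.trans (hq_gt _ h3)
    refine ⟨by rw [time_unbend hG]; exact h1, by rw [time_unbend hG]; exact h2, ?_, ?_⟩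
    · rw [norm_spatial_unbend_sub hG hx, abs_of_pos hpos]
      exact hq_gt _ h3
    · rw [norm_spatial_unbend_sub hG hx, abs_of_pos hpos]
      exact hq_lt _ h4
  · rintro y ⟨-, -, h3, -⟩
    exact unbend_bend hF hG (hne y (by linarith)) (lt_trans (by positivity) (hp_gt _ h3)) (hqp _)
  · rintro x ⟨-, -, h3, -⟩
    exact bend_unbend hF hG (hne x h3) (hM'.trans (hq_gt _ h3)) (hpq _)
  · rintro y ⟨-, -, h3, -⟩
    exact (contDiffAt_bend hF (hne y (by linarith)) hpc.contDiffAt).continuousAt.continuousWithinAt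
  · rintro x ⟨-, -, h3, -⟩
    exact (contDiffAt_unbend hG (hne x h3) hqc.contDiffAt).continuousAt.continuousWithinAt
  · exact (isOpen_lt continuous_const h0c).and ((isOpen_lt h0c continuous_const).and
      ((isOpen_lt continuous_const hdc).and (isOpen_lt hdc continuous_const)))
  · exact (isOpen_lt continuous_const ht₀c).and ((isOpen_lt ht₀c continuous_const).and
      ((isOpen_lt continuous_const hdc).and (isOpen_lt hdc continuous_const)))
  · rintro y ⟨-, -, h3, h4⟩
    have hy := hne y (by linarith)
    show ‖E4.spatial (F y) - ξ‖ < 5 * M' / 4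
    rw [norm_spatial_bend_sub hF hy, abs_of_pos (lt_trans (by positivity) (hp_gt _ h3))]
    exact hp_lt _ h4
  · obtain ⟨-, -, h3, -⟩ := hy
    exact contDiffAt_bend hF (hne y (by linarith)) hpc.contDiffAt
  · exact ⟨by rw [h0]; norm_num, by rw [h0]; norm_num, by linarith, by linarith⟩

/-! ### §2 Bounded tube sections -/

/-- `|v⁰| ≤ ‖v‖` and `|v̲| ≤ ‖v‖` for the Euclidean norm of `E4` (bookkeeping). [folklore] -/
theorem abs_apply_zero_le_norm_and_spatialNorm_le_norm (v : E4) :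
    |v 0| ≤ ‖v‖ ∧ E4.spatialNorm v ≤ ‖v‖ := by
  have h := norm_sq_eq_sq_add_spatialNorm_sq v
  refine ⟨(sq_le_sq₀ (abs_nonneg _) (norm_nonneg v)).mp ?_,
    (sq_le_sq₀ (E4.spatialNorm_nonneg v) (norm_nonneg v)).mp ?_⟩
  · rw [sq_abs]
    nlinarith [sq_nonneg (E4.spatialNorm v)]
  · nlinarith [sq_nonneg (v 0)]

/-- **Bounded tube sections.** For a motion `(Λ, c)`, a spin `a` and a radius `ρ`, the boosted
tube `{x | r_a(Λ⁻¹(x − c)) ≤ ρ}` meets the hyperboloidal layer `{−1 < x⁰ − √(1 + |x̲|²) < 1}` in a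
bounded set.  Write `x = z + s u`, `u = Λ e₀`, `z = c + Λ w`, `w⁰ = 0`: `‖w‖² ≤ ρ² + a²`
(`Kerr.spatialNorm_sq_sub_sq_le_radius_sq`), `((u)⁰)² = 1 + |ũ|²` (`lorentz_apply_zero_sq`), and
`0 < x⁰ < 2 + |x̲|` pinches `|s|` (O'Neill 1983, Ch. 9, p. 233: unit timelike vectors).  Registered
sub-goal `stub_phantomSuccTube` of stmt-FinalStateConjecture-10115 (helper of `stub_phantomSucc`).
[folklore] -/
theorem stub_phantomSuccTube :
    ∀ (Λ : lorentzGroup) (c : E4) (a ρ : ℝ), ∃ D : ℝ, ∀ x : E4,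
      Kerr.radius a (poincareInv Λ c x) ≤ ρ → -1 < x 0 - Real.sqrt (1 + E4.spatialNorm x ^ 2) →
        x 0 - Real.sqrt (1 + E4.spatialNorm x ^ 2) < 1 → ‖x‖ ≤ D := by
  intro Λ c a ρ
  set L : E4 ≃L[ℝ] E4 := (Λ : E4 ≃L[ℝ] E4) with hL
  set u : E4 := L (E4.basisVector 0) with hu
  set γ : ℝ := |u 0| with hγ
  set σ : ℝ := E4.spatialNorm u with hσ
  have hγσ : γ ^ 2 = 1 + σ ^ 2 := by rw [hγ, sq_abs]; exact lorentz_apply_zero_sq Λ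
  have hσ0 : 0 ≤ σ := E4.spatialNorm_nonneg u
  have hγ0 : 0 ≤ γ := abs_nonneg _
  have hγ1 : 1 ≤ γ :=
    (sq_le_sq₀ zero_le_one hγ0).1 (by rw [one_pow, hγσ]; linarith [sq_nonneg σ])
  have hkey : (γ - σ) * (γ + σ) = 1 := by linear_combination hγσ
  set Z : ℝ := ‖c‖ + ‖(L : E4 →L[ℝ] E4)‖ * (|ρ| + |a|) with hZ
  have hZ0 : 0 ≤ Z := by positivity
  refine ⟨Z + (2 + 2 * Z) * (γ + σ) * ‖u‖, fun x hr ht₁ ht₂ ↦ ?_⟩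
  -- the decomposition `x = z + s u`
  set y : E4 := poincareInv Λ c x with hy
  set s : ℝ := y 0 with hs
  set w : E4 := y - s • E4.basisVector 0 with hw
  have hw0 : w 0 = 0 := by simp [hw, hs]
  have hsw : E4.spatial w = E4.spatial y := by
    have h0 : E4.spatial (E4.basisVector 0) = 0 := by
      ext i
      simp [E4.spatial_apply, Fin.succ_ne_zero]
    rw [hw, map_sub, map_smul, h0, smul_zero, sub_zero]
  set z : E4 := c + L w with hz
  have hx : x = z + s • u := by
    have h1 : L y = x - c := by
      rw [hy, poincareInv, hL]
      exact (Λ : E4 ≃L[ℝ] E4).apply_symm_apply _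
    have h2 : y = s • E4.basisVector 0 + w := by rw [hw]; abel
    have h3 : L y = s • u + L w := by rw [h2, map_add, map_smul]
    have h4 : x = c + L y := by rw [h1]; abel
    rw [h4, h3, hz]
    abel
  -- `‖w‖ ≤ |ρ| + |a|`, so `‖z‖ ≤ Z`
  have hwn : ‖w‖ ≤ |ρ| + |a| := by
    rw [norm_eq_spatialNorm_of_apply_zero_eq_zero hw0, E4.spatialNorm, hsw]
    have h1 := Kerr.spatialNorm_sq_sub_sq_le_radius_sq a y
    have h2 : Kerr.radius a y ^ 2 ≤ ρ ^ 2 := pow_le_pow_left₀ (Kerr.radius_nonneg a y) hr 2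
    refine (sq_le_sq₀ (E4.spatialNorm_nonneg y) (by positivity)).mp ?_
    linarith [sq_abs ρ, sq_abs a, mul_nonneg (abs_nonneg ρ) (abs_nonneg a)]
  have hLw : ‖L w‖ ≤ ‖(L : E4 →L[ℝ] E4)‖ * (|ρ| + |a|) :=
    ((L : E4 →L[ℝ] E4).le_opNorm w).trans (mul_le_mul_of_nonneg_left hwn (norm_nonneg _))
  have hzn : ‖z‖ ≤ Z := (norm_add_le _ _).trans (by linarith)
  obtain ⟨hz0, hzs⟩ : |z 0| ≤ Z ∧ E4.spatialNorm z ≤ Z :=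
    (abs_apply_zero_le_norm_and_spatialNorm_le_norm z).imp (·.trans hzn) (·.trans hzn)
  -- the components of `x`
  have hx0 : x 0 = z 0 + s * u 0 := by rw [hx]; simp
  have hxs : E4.spatialNorm x ≤ E4.spatialNorm z + |s| * σ := by
    rw [hx, E4.spatialNorm, map_add, map_smul]
    refine (norm_add_le _ _).trans_eq ?_
    rw [norm_smul, Real.norm_eq_abs]
    rfl
  -- `0 < x⁰ < 2 + |x̲|` on the hyperboloidal layer
  have hsq1 : (1 : ℝ) ≤ √(1 + E4.spatialNorm x ^ 2) := by
    have h : √1 ≤ √(1 + E4.spatialNorm x ^ 2) :=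
      Real.sqrt_le_sqrt (by linarith [sq_nonneg (E4.spatialNorm x)])
    rwa [Real.sqrt_one] at h
  have hsq2 : √(1 + E4.spatialNorm x ^ 2) ≤ 1 + E4.spatialNorm x := by
    have hn := E4.spatialNorm_nonneg x
    calc √(1 + E4.spatialNorm x ^ 2) ≤ √((1 + E4.spatialNorm x) ^ 2) :=
          Real.sqrt_le_sqrt (by nlinarith)
      _ = 1 + E4.spatialNorm x := Real.sqrt_sq (by positivity)
  have hA : 0 < z 0 + s * u 0 := by rw [← hx0]; linarith
  have hB : z 0 + s * u 0 < 2 + E4.spatialNorm z + |s| * σ := by rw [← hx0]; linarith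
  -- pinching `|s|`
  have hsb : |s| ≤ (2 + 2 * Z) * (γ + σ) := by
    have hz0' := abs_le.1 hz0
    rcases le_or_gt 0 (s * u 0) with h | h
    · have h1 : s * u 0 = |s| * γ := by rw [hγ, ← abs_mul, abs_of_nonneg h]
      rw [h1] at hB
      have h2 : |s| * (γ - σ) ≤ 2 + 2 * Z := by linarith
      calc |s| = |s| * (γ - σ) * (γ + σ) := by rw [mul_assoc, hkey, mul_one]
        _ ≤ (2 + 2 * Z) * (γ + σ) := mul_le_mul_of_nonneg_right h2 (by linarith)
    · have h1 : s * u 0 = -(|s| * γ) := by rw [hγ, ← abs_mul, abs_of_neg h]; ring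
      rw [h1] at hA
      have h2 : |s| * γ ≤ Z := by linarith
      have h3 : |s| ≤ |s| * γ := le_mul_of_one_le_right (abs_nonneg s) hγ1
      have h4 : (2 + 2 * Z) * 1 ≤ (2 + 2 * Z) * (γ + σ) :=
        mul_le_mul_of_nonneg_left (by linarith) (by linarith)
      linarith
  -- assembly
  calc ‖x‖ = ‖z + s • u‖ := by rw [hx]
    _ ≤ ‖z‖ + |s| * ‖u‖ := (norm_add_le _ _).trans (by rw [norm_smul, Real.norm_eq_abs])
    _ ≤ Z + (2 + 2 * Z) * (γ + σ) * ‖u‖ :=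
        add_le_add hzn (mul_le_mul_of_nonneg_right hsb (norm_nonneg u))

/-! ### §3 Bookkeeping over `Fin (N + 1)` -/

/-- A union over `Fin (N + 1)` with empty `0`-th member is the union over successors. [folklore] -/
theorem iUnion_eq_of_zero_eq_empty {α : Type*} {N : ℕ} {f : Fin (N + 1) → Set α}
    (h0 : f 0 = ∅) : ⋃ i, f i = ⋃ i : Fin N, f i.succ := by
  ext x
  simp only [mem_iUnion, Fin.exists_fin_succ, h0, mem_empty_iff_false, false_or]

/-- A family over `Fin (N + 1)` whose `0`-th member is empty is pairwise disjoint as soon as its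
successors are. [folklore] -/
theorem pairwise_disjoint_of_zero_eq_empty {α : Type*} {N : ℕ} {f : Fin (N + 1) → Set α}
    (h0 : f 0 = ∅) (h : Pairwise (Function.onFun Disjoint fun i : Fin N => f i.succ)) :
    Pairwise (Function.onFun Disjoint f) := by
  intro i j hij
  cases i using Fin.cases with
  | zero => simp [Function.onFun, h0]
  | succ i =>
    cases j using Fin.cases with
    | zero => simp [Function.onFun, h0]
    | succ j => exact h fun e => hij (congrArg Fin.succ e)

end PhantomSucc

end Summit.FinalStateConjecture.FinalStateConjecture.Theorems.BartnikGapSettling.Capture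

end
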